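import Literature.AlgebraicGeometry.ShimuraVarieties.Deligne1979ComplexPoints
import Literature.AlgebraicGeometry.HodgeTheory.TopDegreeClasses
import Literature.AlgebraicGeometry.Motives.BaseChangeProofs
import Literature.AlgebraicGeometry.Motives.BaseChangePointsProofs
import HarnessLib

/-!
# A geometrically irreducible model of `Sh_K` forces one geometric component (`|Ξ_K| = 1`)

Deligne 1979, §2.1.3 (first line), for the unitary datum `(U(H), 𝔹²)` of a hermitian `3`-space over a CM
field `L`: the set of connected components of
`Sh_K(ℂ) = U(H)(L⁺) \ [𝔹² × U(H)(𝔸_{L⁺,f}) / K]` is the finite index set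
`Ξ_K = U(H)(L⁺) \ U(H)(𝔸_{L⁺,f}) / K` (the tree's `Deligne1979.connectedComponents_equiv_index`).  Hence a
scheme `M` over a subfield `k ⊆ ℂ` whose complex points are homeomorphic to `Sh_K(ℂ)` and which is a
smooth projective VARIETY in the tree's sense `Motives.IsSmoothProjective n M` — a structure whose third
field is `GeometricallyIrreducible M.hom` — has CONNECTED complex points (irreducible complex varieties are
connected in the analytic topology, SGA1 XII Prop. 2.4 = the tree's `HodgeTheory.connectedSpace_complexPoints`,
transported along `X(ℂ) ≃ₜ X_σ(ℂ)`, `AlgPoints.isHomeomorph_baseChangeEquiv_holds`), so `Ξ_K` is a single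
class: `U(H)(𝔸_{L⁺,f}) = U(H)(L⁺) · K` ("class number one at level `K`").  Contrapositively, as soon as
`Ξ_K` has two classes there is NO such model (`isEmpty_homeomorph_shimuraSet_of_nontrivial_index`).

Use (cells pub-hodgecm / pub-hodgecm2, S2 pinning record, residual (R1)): a canonical-model record for
`Sh_K` over the reflex field typed with the field `IsSmoothProjective 2 M` is uninhabited at every level `K`
with `|Ξ_K| ≥ 2`; Shimura varieties are smooth and (in the Compact Case) projective over `E` but in general
NOT geometrically connected (Deligne 1979, 2.1.3 and Thm. 2.6.3; Milne 2005, Thm. 5.17: `π₀ = T(ℚ)† \ T(𝔸_f)/ν(K)`),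
so the model's carrier must be typed `SmoothOfRelativeDimension 2 M.hom ∧ IsProjectiveOver M` without the
geometric-irreducibility clause.  All statements here are THEOREMS over existing tree carriers; no definition,
no named fact.

## References
* [Deligne1979ShimuraVarieties] P. Deligne, *Variétés de Shimura*, Proc. Symp. Pure Math. 33.2 (1979), §2.1.2–2.1.3.
* [Milne2005ShimuraVarieties] J. S. Milne, *Introduction to Shimura varieties* (2005), Lemma 5.13, Theorem 5.17.
* [SGA1] A. Grothendieck, M. Raynaud, SGA 1, Exp. XII Prop. 2.4.
-/

set_option autoImplicit false

noncomputable section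

open Function MulAction Topology NumberField
open Literature.AlgebraicGeometry.Motives
open Literature.NumberTheory.Automorphic Literature.NumberTheory.Automorphic.UnitaryGroup
open Literature.NumberTheory.Automorphic.ShimuraDissection
open Literature.Geometry.ComplexHyperbolic Literature.Geometry.ComplexHyperbolic.BallModel

namespace Literature.AlgebraicGeometry.ShimuraVarieties

/-! ### Complex points of a smooth projective variety over a subfield of `ℂ` are connected -/

/-- **The complex points of a smooth projective variety over `k ⊆ ℂ` are connected.**  For a field map
`σ : k →+* ℂ` and `M` smooth projective (geometrically irreducible) of dimension `n` over `k`, the space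
`M(ℂ)` of `ℂ`-points along `σ` (analytic topology) is connected: `M_σ = M ×_{k,σ} ℂ` is smooth projective
over `ℂ` (`IsSmoothProjective.baseChangeHom_holds`), `M_σ(ℂ)` is connected (SGA1 XII Prop. 2.4, the tree's
`HodgeTheory.connectedSpace_complexPoints`), and `M(ℂ) ≃ₜ M_σ(ℂ)` (`AlgPoints.isHomeomorph_baseChangeEquiv_holds`).
[cite: SGA1, Exp. XII Prop. 2.4] -/
theorem connectedSpace_complexPoints_of_isSmoothProjective_ringHom {k : Type} [Field k] (σ : k →+* ℂ)
    {n : ℕ} {M : SchemeOver k} (hM : IsSmoothProjective n M) :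
    letI := σ.toAlgebra
    ConnectedSpace (ComplexPoints M) := by
  letI := σ.toAlgebra
  have hM' : IsSmoothProjective n ((baseChangeHom σ).obj M) :=
    IsSmoothProjective.baseChangeHom_holds σ hM
  haveI : ConnectedSpace (ComplexPoints ((baseChangeHom σ).obj M)) :=
    Literature.AlgebraicGeometry.HodgeTheory.connectedSpace_complexPoints hM'
  have hh : IsHomeomorph (AlgPoints.baseChangeEquiv σ M :
      AlgPoints M ℂ → AlgPoints ((baseChangeHom σ).obj M) ℂ) :=
    AlgPoints.isHomeomorph_baseChangeEquiv_holds σ M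
  let e : AlgPoints M ℂ ≃ₜ AlgPoints ((baseChangeHom σ).obj M) ℂ := hh.homeomorph
  exact e.symm.surjective.connectedSpace e.symm.continuous

namespace Deligne1979

variable (L : Type) [Field L] [NumberField L] [IsCMField L] (H : Matrix (Fin 3) (Fin 3) L)
  (τ : L →+* ℂ) (T : GL (Fin 3) ℂ) (hT : formCongr (starRingEnd ℂ) T (H.map τ) = BallModel.J)
  (K : Subgroup (finAdelic (↥(maximalRealSubfield L)) L (IsCMField.complexConj L) 3 H))

/-! ### Connected `Sh_K(ℂ)` ⟺ one double coset -/

/-- **Deligne 1979 §2.1.3, connected case**: if `Sh_K(ℂ)` is connected (and `K` is open) then the index set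
`Ξ_K = U(H)(L⁺) \ U(H)(𝔸_{L⁺,f}) / K` of its connected components is a single class.
[cite: Deligne1979ShimuraVarieties, §2.1.3] -/
theorem subsingleton_index_of_connectedSpace
    (hK : IsOpen (K : Set (finAdelic (↥(maximalRealSubfield L)) L (IsCMField.complexConj L) 3 H)))
    [ConnectedSpace (ShimuraSet L H τ T hT K)] :
    Subsingleton (orbitRel.Quotient (rational (↥(maximalRealSubfield L)) L (IsCMField.complexConj L) 3 H)
      (CosetSpace (rationalToFinAdelic (↥(maximalRealSubfield L)) L (IsCMField.complexConj L) 3 H) K)) := by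
  obtain ⟨π, -⟩ := connectedComponents_equiv_index L H τ T hT K hK
  haveI : Subsingleton (ConnectedComponents (ShimuraSet L H τ T hT K)) := ⟨fun a b => by
    obtain ⟨x, rfl⟩ := ConnectedComponents.surjective_coe a
    obtain ⟨y, rfl⟩ := ConnectedComponents.surjective_coe b
    rw [ConnectedComponents.coe_eq_coe', PreconnectedSpace.connectedComponent_eq_univ]
    exact Set.mem_univ _⟩
  exact π.symm.subsingleton

/-- **Class number one at level `K`**, the same statement on group elements: if `Sh_K(ℂ)` is connected
(`K` open) then every finite-adelic point is a rational point times an element of `K`,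
`U(H)(𝔸_{L⁺,f}) = U(H)(L⁺) · K`. [cite: Deligne1979ShimuraVarieties, §2.1.3] -/
theorem exists_eq_rational_mul_of_connectedSpace
    (hK : IsOpen (K : Set (finAdelic (↥(maximalRealSubfield L)) L (IsCMField.complexConj L) 3 H)))
    [ConnectedSpace (ShimuraSet L H τ T hT K)]
    (a : finAdelic (↥(maximalRealSubfield L)) L (IsCMField.complexConj L) 3 H) :
    ∃ (γ : rational (↥(maximalRealSubfield L)) L (IsCMField.complexConj L) 3 H)
      (κ : finAdelic (↥(maximalRealSubfield L)) L (IsCMField.complexConj L) 3 H), κ ∈ K ∧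
        a = rationalToFinAdelic (↥(maximalRealSubfield L)) L (IsCMField.complexConj L) 3 H γ * κ := by
  haveI := subsingleton_index_of_connectedSpace L H τ T hT K hK
  have h : (Quotient.mk'' (CosetSpace.pt (rationalToFinAdelic _ L _ 3 H) K a) :
      orbitRel.Quotient (rational (↥(maximalRealSubfield L)) L (IsCMField.complexConj L) 3 H)
        (CosetSpace (rationalToFinAdelic (↥(maximalRealSubfield L)) L (IsCMField.complexConj L) 3 H) K)) =
      Quotient.mk'' (CosetSpace.pt (rationalToFinAdelic _ L _ 3 H) K 1) :=
    Subsingleton.elim _ _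
  obtain ⟨γ, hγ⟩ := mem_orbit_iff.mp (Quotient.eq''.mp h)
  rw [CosetSpace.smul_pt, mul_one, CosetSpace.pt_eq_pt_iff] at hγ
  exact ⟨γ, _, hγ, by rw [mul_inv_cancel_left]⟩

/-! ### A geometrically irreducible model forces `|Ξ_K| = 1` -/

/-- **A smooth projective VARIETY modelling `Sh_K` has exactly one geometric component.**  Let `k ⊆ ℂ`
(`σ : k →+* ℂ`), `M` a smooth projective geometrically irreducible `k`-scheme (`IsSmoothProjective n M`), and
suppose its complex points along `σ` are homeomorphic to `Sh_K(ℂ) = U(H)(L⁺) \ [𝔹² × U(H)(𝔸_{L⁺,f})/K]`,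
`K` open.  Then `Ξ_K = U(H)(L⁺) \ U(H)(𝔸_{L⁺,f}) / K` is a single class (Deligne 1979 §2.1.3:
`π₀(Sh_K ⊗ ℂ) = Ξ_K`; a geometrically irreducible variety has connected complex points, SGA1 XII 2.4).
In particular an `E`-MODEL of `Sh_K` can be a "smooth projective variety" in this sense only at the levels of
class number one; Shimura varieties are in general not geometrically connected (Deligne 1979, 2.1.3, 2.6.3).
[cite: Deligne1979ShimuraVarieties, §2.1.3] -/
theorem subsingleton_index_of_isSmoothProjective_model {k : Type} [Field k] (σ : k →+* ℂ) {n : ℕ}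
    {M : SchemeOver k} (hM : IsSmoothProjective n M)
    (hK : IsOpen (K : Set (finAdelic (↥(maximalRealSubfield L)) L (IsCMField.complexConj L) 3 H)))
    (e : letI := σ.toAlgebra; ComplexPoints M ≃ₜ ShimuraSet L H τ T hT K) :
    Subsingleton (orbitRel.Quotient (rational (↥(maximalRealSubfield L)) L (IsCMField.complexConj L) 3 H)
      (CosetSpace (rationalToFinAdelic (↥(maximalRealSubfield L)) L (IsCMField.complexConj L) 3 H) K)) := by
  letI := σ.toAlgebra
  haveI := connectedSpace_complexPoints_of_isSmoothProjective_ringHom σ hM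
  haveI : ConnectedSpace (ShimuraSet L H τ T hT K) := e.surjective.connectedSpace e.continuous
  exact subsingleton_index_of_connectedSpace L H τ T hT K hK

/-- **Class number one is forced by a smooth projective variety model**: under the hypotheses of
`subsingleton_index_of_isSmoothProjective_model`, `U(H)(𝔸_{L⁺,f}) = U(H)(L⁺) · K`.
[cite: Deligne1979ShimuraVarieties, §2.1.3] -/
theorem exists_eq_rational_mul_of_isSmoothProjective_model {k : Type} [Field k] (σ : k →+* ℂ) {n : ℕ}
    {M : SchemeOver k} (hM : IsSmoothProjective n M)
    (hK : IsOpen (K : Set (finAdelic (↥(maximalRealSubfield L)) L (IsCMField.complexConj L) 3 H)))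
    (e : letI := σ.toAlgebra; ComplexPoints M ≃ₜ ShimuraSet L H τ T hT K)
    (a : finAdelic (↥(maximalRealSubfield L)) L (IsCMField.complexConj L) 3 H) :
    ∃ (γ : rational (↥(maximalRealSubfield L)) L (IsCMField.complexConj L) 3 H)
      (κ : finAdelic (↥(maximalRealSubfield L)) L (IsCMField.complexConj L) 3 H), κ ∈ K ∧
        a = rationalToFinAdelic (↥(maximalRealSubfield L)) L (IsCMField.complexConj L) 3 H γ * κ := by
  letI := σ.toAlgebra
  haveI := connectedSpace_complexPoints_of_isSmoothProjective_ringHom σ hM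
  haveI : ConnectedSpace (ShimuraSet L H τ T hT K) := e.surjective.connectedSpace e.continuous
  exact exists_eq_rational_mul_of_connectedSpace L H τ T hT K hK a

/-- **No smooth projective VARIETY models `Sh_K` once `Ξ_K` has two classes**: for `K` open with
`Ξ_K = U(H)(L⁺) \ U(H)(𝔸_{L⁺,f}) / K` non-trivial, there is no homeomorphism between the complex points of
a smooth projective geometrically irreducible `k`-scheme (`k ⊆ ℂ`) and `Sh_K(ℂ)` — the vacuity witness for any
model record typed with `IsSmoothProjective`. [cite: Deligne1979ShimuraVarieties, §2.1.3] -/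
theorem isEmpty_homeomorph_shimuraSet_of_nontrivial_index {k : Type} [Field k] (σ : k →+* ℂ) {n : ℕ}
    {M : SchemeOver k} (hM : IsSmoothProjective n M)
    (hK : IsOpen (K : Set (finAdelic (↥(maximalRealSubfield L)) L (IsCMField.complexConj L) 3 H)))
    [hΞ : Nontrivial (orbitRel.Quotient (rational (↥(maximalRealSubfield L)) L (IsCMField.complexConj L) 3 H)
      (CosetSpace (rationalToFinAdelic (↥(maximalRealSubfield L)) L (IsCMField.complexConj L) 3 H) K))] :
    IsEmpty (letI := σ.toAlgebra; ComplexPoints M ≃ₜ ShimuraSet L H τ T hT K) :=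
  ⟨fun e => not_subsingleton _ (subsingleton_index_of_isSmoothProjective_model L H τ T hT K σ hM hK e)⟩

end Deligne1979

end Literature.AlgebraicGeometry.ShimuraVarieties

end
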